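import Literature.AlgebraicGeometry.AbelianSchemes.PoincarePointRestrictingToUnit
import Literature.AlgebraicGeometry.Modules.AffineTestObjects
import Literature.AlgebraicGeometry.Modules.CechUnitModuleHZeroScalars
import HarnessLib

/-!
# Affine test objects of the form `Spec B → T` given by a ring map `Γ(T, 𝒪) → B`: structure maps, transition maps, surjectivity, and the unit-point criterion
# ([GortzWedhorn2023] Prop. 22.90 / (4.7); [MumfordAV1970] §13, proof of the Theorem)

Layer `Literature/AlgebraicGeometry/AbelianSchemes` (§1–§2 generic, namespace `Literature.AlgebraicGeometry.Modules`; §3 namespace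
`Literature.AlgebraicGeometry.AbelianSchemes.AbelianSchemeOver`).  THEOREMS ONLY (no definition, no named fact, no instance, no notation, no `sorry`).
Cell `hodgecm-mathlib` (D-0151), junction (geo-T) of the «H1-DIM-ANY-CHAR cut» (B-p04 memo v3 §2).  For an AFFINE test base `T` over a field `K`
(★ `Modules/AffineTestObjects`) and a ring map `φ : Γ(T, 𝒪) → B` the test object «`Spec B → T`» is, WITHOUT any new definition,
`Over.homMk x_φ rfl : Over.mk (x_φ ≫ T.hom) ⟶ T` with `x_φ := Spec.map (CommRingCat.ofHom φ) ≫ T.left.isoSpec.inv`.  This file supplies what the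
H1-DIM HEAD needs to feed the abstract test algebras `R ⧸ J`, `ResidueField R` of ★ `BaseChangeComplexReprModuleResidueField` into the geometric
statements of ★ `PoincareKernelReprTests` (via ★ `KernelBaseChangeTestAlgebraTransport`):

* §1 `ΓSpecIso_hom_appTop_specMap_comp_isoSpec_inv` — `(ΓSpecIso B)(x_φ♯(a)) = φ a`; `ΓSpecIso_hom_testRingHom` — the same for the structure map
  `testRingHom T (Over.homMk x_φ rfl)` of ★ `AffineTestObjects`; `specMap_comp_eq_of_comp` — `Spec ψ ≫ x_φ = x_{ψ ∘ φ}`; `ΓSpecIso_hom_testAlgHom` — the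
  transition map `testAlgHom` of the test objects of `φ` and `ψ ∘ φ` along `Spec ψ` is `ψ` under the `ΓSpecIso`'s.
* §2 `surjective_specMap_of_subsingleton` — `Spec C → Spec B` is surjective when `Spec B` has at most one point and `C` is non-trivial;
  `subsingleton_primeSpectrum_quotient_of_sq_le` — `Spec(R ⧸ J)` is one point for `R` local and `𝔪² ≤ J`.
* §3 (abelian schemes; `gT : T → Â` with `gT.left` a monomorphism and a `K`-point `t₀ : Spec K → T` over the unit section) **`apply_eq_zero_of_homMk_comp_eq_one`**
  — if the test object of `φ` lies over the unit point (`Over.homMk x_φ rfl ≫ gT = 1`) then `φ` kills `ker t₀♯`; **`homMk_comp_eq_one_of_forall_apply_eq_zero`**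
  — conversely, if `φ` kills `ker t₀♯` (`t₀♯` surjective) then the test object of `φ` lies over the unit point.

HC_CM is proved only modulo the 7 printed citations until rung 0 closes; nothing here bears on a summit statement (count-neutral capital).

## References
* [GortzWedhorn2023] U. Görtz, T. Wedhorn, *Algebraic Geometry II* (2023), Prop. 22.90 (p. 277), proof; *Algebraic Geometry I* (2020), (4.7) (p. 135).
* [MumfordAV1970] D. Mumford, *Abelian Varieties* (1970), §13, proof of the Theorem (pp. 127–129).
-/

set_option autoImplicit false

open CategoryTheory CategoryTheory.Limits AlgebraicGeometry MonoidalCategory CartesianMonoidalCategory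
open scoped MonObj

noncomputable section

namespace Literature.AlgebraicGeometry.Modules

open Literature.AlgebraicGeometry.Motives

/-! ## §1 Structure and transition maps of the test objects `Spec B → T` -/

section SpecTest

variable {K : Type} [Field K] (T : SchemeOver K) [IsAffine T.left] {B C : Type} [CommRing B] [CommRing C]
  (φ : Γ(T.left, ⊤) →+* B) (ψ : B →+* C)

omit [IsAffine T.left] in
/-- `x.appLE ⊤ ⊤ _ = x.appTop` on elements (the structure map `testRingHom` of ★ `AffineTestObjects` is `x♯` on global sections).
[cite: GortzWedhorn2023, Prop. 22.90 (p. 277), proof] -/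
theorem testRingHom_homMk_apply {Y : Scheme.{0}} (x : Y ⟶ T.left) (a : Γ(T.left, ⊤)) :
    testRingHom T (Over.homMk x rfl : Over.mk (x ≫ T.hom) ⟶ T) a = x.appTop.hom a := by
  change toSections x.appTop.hom ⊤ a = x.appTop.hom a
  exact toSections_top x.appTop.hom a

/-- **`(ΓSpecIso B)(x_φ♯ a) = φ a`** for `x_φ = Spec φ ≫ isoSpec⁻¹ : Spec B → T`. [cite: GortzWedhorn2023, Prop. 22.90 (p. 277), proof] -/
theorem ΓSpecIso_hom_appTop_specMap_comp_isoSpec_inv (a : Γ(T.left, ⊤)) :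
    (Scheme.ΓSpecIso (.of B)).hom ((Spec.map (CommRingCat.ofHom φ) ≫ T.left.isoSpec.inv).appTop.hom a) = φ a := by
  -- `isoSpec⁻¹♯ = (ΓSpecIso Γ(T))⁻¹`
  have hinv : T.left.isoSpec.inv.appTop = (Scheme.ΓSpecIso Γ(T.left, ⊤)).inv := by
    have h1 : (T.left.isoSpec.inv ≫ T.left.toSpecΓ).appTop = 𝟙 _ := by
      rw [Scheme.isoSpec_inv_toSpecΓ]; rfl
    rw [Scheme.Hom.comp_appTop, Scheme.toSpecΓ_appTop] at h1
    rw [← cancel_epi (Scheme.ΓSpecIso Γ(T.left, ⊤)).hom, h1, Iso.hom_inv_id]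
  have hnat := Scheme.ΓSpecIso_naturality (CommRingCat.ofHom φ)
  rw [Scheme.Hom.comp_appTop, hinv]
  change ((Scheme.ΓSpecIso Γ(T.left, ⊤)).inv ≫ (Spec.map (CommRingCat.ofHom φ)).appTop ≫ (Scheme.ΓSpecIso (.of B)).hom) a = φ a
  rw [hnat]
  change ((Scheme.ΓSpecIso Γ(T.left, ⊤)).inv ≫ (Scheme.ΓSpecIso Γ(T.left, ⊤)).hom ≫ CommRingCat.ofHom φ) a = φ a
  rw [Iso.inv_hom_id_assoc]
  rfl

/-- **The structure map of the test object of `φ` is `φ`** under `ΓSpecIso`: `(ΓSpecIso B)(testRingHom T (Over.homMk x_φ) a) = φ a`.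
[cite: GortzWedhorn2023, Prop. 22.90 (p. 277), proof] -/
theorem ΓSpecIso_hom_testRingHom (a : Γ(T.left, ⊤)) :
    (Scheme.ΓSpecIso (.of B)).hom (testRingHom T (Over.homMk (Spec.map (CommRingCat.ofHom φ) ≫ T.left.isoSpec.inv) rfl :
        Over.mk ((Spec.map (CommRingCat.ofHom φ) ≫ T.left.isoSpec.inv) ≫ T.hom) ⟶ T) a) = φ a := by
  change (Scheme.ΓSpecIso (.of B)).hom (toSections (Spec.map (CommRingCat.ofHom φ) ≫ T.left.isoSpec.inv).appTop.hom ⊤ a) = φ a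
  rw [toSections_top]
  exact ΓSpecIso_hom_appTop_specMap_comp_isoSpec_inv T φ a

omit [IsAffine T.left] in
/-- `Spec ψ ≫ x_φ = x_{ψ ∘ φ}` (as morphisms `Spec C → T`), for any `x : Spec B → T` in place of `isoSpec⁻¹`. [cite: GortzWedhorn2023, (4.7) (p. 135)] -/
theorem specMap_comp_specMap_comp {Y : Scheme.{0}} (x : Spec (.of Γ(T.left, ⊤)) ⟶ Y) :
    Spec.map (CommRingCat.ofHom ψ) ≫ (Spec.map (CommRingCat.ofHom φ) ≫ x) = Spec.map (CommRingCat.ofHom (ψ.comp φ)) ≫ x := by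
  rw [← Category.assoc, ← Spec.map_comp, ← CommRingCat.ofHom_comp]

/-- **The transition map is `ψ`**: for the test objects of `φ` and of `ψ ∘ φ` and the morphism `Spec ψ` between them (a morphism over `T` by
`specMap_comp_specMap_comp`), `(ΓSpecIso C)(testAlgHom … b) = ψ ((ΓSpecIso B) b)`. [cite: GortzWedhorn2023, Prop. 22.90 (p. 277), proof] -/
theorem ΓSpecIso_hom_testAlgHom
    (hk : (Over.homMk (Spec.map (CommRingCat.ofHom ψ)) (by
        change Spec.map (CommRingCat.ofHom ψ) ≫ (Spec.map (CommRingCat.ofHom φ) ≫ T.left.isoSpec.inv) ≫ T.hom =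
          (Spec.map (CommRingCat.ofHom (ψ.comp φ)) ≫ T.left.isoSpec.inv) ≫ T.hom
        rw [← Category.assoc, ← Category.assoc (Spec.map _), ← Spec.map_comp, ← CommRingCat.ofHom_comp]) :
        Over.mk ((Spec.map (CommRingCat.ofHom (ψ.comp φ)) ≫ T.left.isoSpec.inv) ≫ T.hom) ⟶
          Over.mk ((Spec.map (CommRingCat.ofHom φ) ≫ T.left.isoSpec.inv) ≫ T.hom)) ≫
        Over.homMk (Spec.map (CommRingCat.ofHom φ) ≫ T.left.isoSpec.inv) rfl =
      Over.homMk (Spec.map (CommRingCat.ofHom (ψ.comp φ)) ≫ T.left.isoSpec.inv) rfl) (b : Γ(Spec (.of B), ⊤)) :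
    letI := testAlgebra T (Over.homMk (Spec.map (CommRingCat.ofHom φ) ≫ T.left.isoSpec.inv) rfl :
      Over.mk ((Spec.map (CommRingCat.ofHom φ) ≫ T.left.isoSpec.inv) ≫ T.hom) ⟶ T)
    letI := testAlgebra T (Over.homMk (Spec.map (CommRingCat.ofHom (ψ.comp φ)) ≫ T.left.isoSpec.inv) rfl :
      Over.mk ((Spec.map (CommRingCat.ofHom (ψ.comp φ)) ≫ T.left.isoSpec.inv) ≫ T.hom) ⟶ T)
    (Scheme.ΓSpecIso (.of C)).hom (testAlgHom T _ _ _ hk b) = ψ ((Scheme.ΓSpecIso (.of B)).hom b) := by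
  change (Scheme.ΓSpecIso (.of C)).hom (toSections (Spec.map (CommRingCat.ofHom ψ)).appTop.hom ⊤ b) = _
  rw [toSections_top]
  have hnat := Scheme.ΓSpecIso_naturality (CommRingCat.ofHom ψ)
  have h := congrArg (fun f => f b) (congrArg CommRingCat.Hom.hom hnat)
  exact h

end SpecTest

/-! ## §2 Surjectivity of `Spec C → Spec B` onto a one-point spectrum -/

section Surj

/-- `Spec C → Spec B` is surjective as soon as `Spec B` has at most one point and `C` is non-trivial. [cite: GortzWedhorn2023, (4.7) (p. 135)] -/
theorem surjective_specMap_of_subsingleton {B C : Type} [CommRing B] [CommRing C] [Nontrivial C] (ψ : B →+* C)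
    (hB : Subsingleton (PrimeSpectrum B)) : Surjective (Spec.map (CommRingCat.ofHom ψ)) := by
  refine ⟨fun x => ?_⟩
  obtain ⟨y⟩ : Nonempty (PrimeSpectrum C) := inferInstance
  exact ⟨y, @Subsingleton.elim _ hB _ _⟩

/-- **`Spec(R ⧸ J)` is a single point** for `R` local and `𝔪² ≤ J`: every prime of `R ⧸ J` pulls back to a prime containing `𝔪²`, hence equal to `𝔪`.
[cite: MumfordAV1970, §13, proof of the Theorem (pp. 127–129)] -/
theorem subsingleton_primeSpectrum_quotient_of_sq_le {R : Type} [CommRing R] [IsLocalRing R] (J : Ideal R)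
    (hJ : IsLocalRing.maximalIdeal R • IsLocalRing.maximalIdeal R ≤ J) : Subsingleton (PrimeSpectrum (R ⧸ J)) := by
  have hcomap : ∀ P : PrimeSpectrum (R ⧸ J), P.asIdeal.comap (Ideal.Quotient.mk J) = IsLocalRing.maximalIdeal R := by
    intro P
    have hP : (P.asIdeal.comap (Ideal.Quotient.mk J)).IsPrime := Ideal.comap_isPrime _ _
    refine (IsLocalRing.le_maximalIdeal hP.ne_top).antisymm fun r hr => ?_
    have hr2 : r * r ∈ P.asIdeal.comap (Ideal.Quotient.mk J) := by
      have hJ' : r * r ∈ J := hJ (Submodule.smul_mem_smul hr hr)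
      rw [Ideal.mem_comap, Ideal.Quotient.eq_zero_iff_mem.mpr hJ']
      exact P.asIdeal.zero_mem
    exact (hP.mem_or_mem hr2).elim id id
  refine ⟨fun P Q => PrimeSpectrum.ext ?_⟩
  rw [← Ideal.map_comap_of_surjective (Ideal.Quotient.mk J) Ideal.Quotient.mk_surjective P.asIdeal,
    ← Ideal.map_comap_of_surjective (Ideal.Quotient.mk J) Ideal.Quotient.mk_surjective Q.asIdeal, hcomap, hcomap]

end Surj

end Literature.AlgebraicGeometry.Modules

/-! ## §3 Test objects over the unit point of `Â` -/

namespace Literature.AlgebraicGeometry.AbelianSchemes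

namespace AbelianSchemeOver

open Literature.AlgebraicGeometry.Motives Literature.AlgebraicGeometry.Modules

variable {K : Type} [Field K] (hat : AbelianSchemeOver (Spec (CommRingCat.of K))) (T : SchemeOver K) [IsAffine T.left]
  (gT : T ⟶ hat.X) (t₀ : Spec (CommRingCat.of K) ⟶ T.left) (ht₀ : t₀ ≫ gT.left = hat.unitSection)
  {B : Type} [CommRing B] (φ : Γ(T.left, ⊤) →+* B)

omit [IsAffine T.left] in
/-- `(1 : Y ⟶ Â).left = Y.hom ≫ ε_Â` (a private copy of ★ `HomFactorsThroughMulNLocus.one_left_eq_hom_comp_unitSection`, whose module is too heavy to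
import here). [cite: MumfordAV1970, §13, proof of the Theorem (pp. 127–129)] -/
private theorem one_left_eq' (Y : SchemeOver K) : (1 : Y ⟶ hat.X).left = Y.hom ≫ hat.unitSection := by
  rw [Hom.one_def, Over.comp_left, Over.toUnit_left]
  rfl

include ht₀ in
/-- **A test object `Spec B → T` over the unit point of `Â` kills `ker t₀♯`**: if `Over.homMk x_φ ≫ gT = 1` (with `gT : T → Â` injective as a morphism of
schemes and `t₀ : Spec K → T` THE `K`-point over the unit section), then `x_φ` factors through `t₀`, so `φ a = 0` whenever `t₀♯ a = 0`.
[cite: MumfordAV1970, §13, proof of the Theorem (pp. 127–129)] -/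
theorem apply_eq_zero_of_homMk_comp_eq_one [Mono gT.left]
    (h1 : (Over.homMk (Spec.map (CommRingCat.ofHom φ) ≫ T.left.isoSpec.inv) rfl :
        Over.mk ((Spec.map (CommRingCat.ofHom φ) ≫ T.left.isoSpec.inv) ≫ T.hom) ⟶ T) ≫ gT = 1)
    (a : Γ(T.left, ⊤)) (ha : t₀.appTop.hom a = 0) : φ a = 0 := by
  -- `x_φ ≫ gT = (x_φ ≫ T.hom) ≫ ε = (x_φ ≫ T.hom) ≫ t₀ ≫ gT`, so `x_φ = (x_φ ≫ T.hom) ≫ t₀`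
  have hl : ((Over.homMk (Spec.map (CommRingCat.ofHom φ) ≫ T.left.isoSpec.inv) rfl :
      Over.mk ((Spec.map (CommRingCat.ofHom φ) ≫ T.left.isoSpec.inv) ≫ T.hom) ⟶ T) ≫ gT).left =
      (1 : Over.mk ((Spec.map (CommRingCat.ofHom φ) ≫ T.left.isoSpec.inv) ≫ T.hom) ⟶ hat.X).left := by rw [h1]
  rw [one_left_eq'] at hl
  change (Spec.map (CommRingCat.ofHom φ) ≫ T.left.isoSpec.inv) ≫ gT.left =
    ((Spec.map (CommRingCat.ofHom φ) ≫ T.left.isoSpec.inv) ≫ T.hom) ≫ hat.unitSection at hl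
  rw [← ht₀, ← Category.assoc ((Spec.map (CommRingCat.ofHom φ) ≫ T.left.isoSpec.inv) ≫ T.hom)] at hl
  have hx : Spec.map (CommRingCat.ofHom φ) ≫ T.left.isoSpec.inv =
      ((Spec.map (CommRingCat.ofHom φ) ≫ T.left.isoSpec.inv) ≫ T.hom) ≫ t₀ := (cancel_mono gT.left).mp hl
  rw [← ΓSpecIso_hom_appTop_specMap_comp_isoSpec_inv T φ a]
  have happ : (Spec.map (CommRingCat.ofHom φ) ≫ T.left.isoSpec.inv).appTop.hom a =
      (((Spec.map (CommRingCat.ofHom φ) ≫ T.left.isoSpec.inv) ≫ T.hom).appTop.hom) (t₀.appTop.hom a) := by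
    conv_lhs => rw [hx]
    rw [Scheme.Hom.comp_appTop]
    rfl
  rw [happ, ha, map_zero, map_zero]

include ht₀ in
/-- **Conversely**: if `t₀♯ : Γ(T, 𝒪) → Γ(Spec K, 𝒪)` is surjective, `t₀` is a `K`-point (`t₀ ≫ T.hom = 𝟙`) and `φ` kills `ker t₀♯`, then the test object of
`φ` lies over the unit point: `Over.homMk x_φ ≫ gT = 1` (`φ = ψ ∘ t₀♯`, so `x_φ = Spec ψ ≫ isoSpec⁻¹ ≫ t₀` by naturality of `isoSpec`).
[cite: MumfordAV1970, §13, proof of the Theorem (pp. 127–129)] -/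
theorem homMk_comp_eq_one_of_forall_apply_eq_zero (ht₀K : t₀ ≫ T.hom = 𝟙 _) (hsurj : Function.Surjective t₀.appTop.hom)
    (hker : ∀ a, t₀.appTop.hom a = 0 → φ a = 0) :
    (Over.homMk (Spec.map (CommRingCat.ofHom φ) ≫ T.left.isoSpec.inv) rfl :
        Over.mk ((Spec.map (CommRingCat.ofHom φ) ≫ T.left.isoSpec.inv) ≫ T.hom) ⟶ T) ≫ gT = 1 := by
  -- factor `φ = ψ ∘ t₀♯`
  have hle : RingHom.ker t₀.appTop.hom ≤ RingHom.ker φ := fun a ha => hker a ha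
  let ψ : Γ(Spec (CommRingCat.of K), ⊤) →+* B := t₀.appTop.hom.liftOfSurjective hsurj ⟨φ, hle⟩
  have hψ : ψ.comp t₀.appTop.hom = φ := RingHom.liftOfRightInverse_comp _ _ _ ⟨φ, hle⟩
  -- `x_φ = Spec ψ ≫ isoSpec⁻¹ ≫ t₀`
  have hx : Spec.map (CommRingCat.ofHom φ) ≫ T.left.isoSpec.inv =
      Spec.map (CommRingCat.ofHom ψ) ≫ (Spec (CommRingCat.of K)).isoSpec.inv ≫ t₀ := by
    rw [← hψ, CommRingCat.ofHom_comp, Spec.map_comp, Category.assoc]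
    change Spec.map (CommRingCat.ofHom ψ) ≫ Spec.map t₀.appTop ≫ T.left.isoSpec.inv = _
    rw [Scheme.isoSpec_inv_naturality]
  apply Over.OverMorphism.ext
  rw [Over.comp_left, one_left_eq']
  change (Spec.map (CommRingCat.ofHom φ) ≫ T.left.isoSpec.inv) ≫ gT.left =
    ((Spec.map (CommRingCat.ofHom φ) ≫ T.left.isoSpec.inv) ≫ T.hom) ≫ hat.unitSection
  rw [← ht₀, hx]
  simp only [Category.assoc]
  rw [reassoc_of% ht₀K]

end AbelianSchemeOver

end Literature.AlgebraicGeometry.AbelianSchemes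

end
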